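import Literature.Probability.LatticeModels.VonMisesMoments
import Literature.Probability.LatticeModels.MMPInequality
import HarnessLib

/-!
# The Nishimori path identity `𝔼_β[⟨e^{i(θ(y)−θ(x))}⟩_u · U_p(u)] = λ^{|p|}`

C. Garban, T. Spencer, J. Math. Phys. **63** (2022) 093302 = arXiv:2109.01617, §2, Step 1 of the
proof of Theorem 1.3 ((2.7)–(2.8)): for a simple path `p` from `x` to `y`, the telescoping
`e^{i(θ(y) − θ(x))} ∏_{(ij)∈p} e^{iω_{ij}} = ∏_{(ij) ∈ p} Y_{ij}` and Lemma 2.1 give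
`𝔼_β[⟨∏_{(ij)∈p} Y_{ij}⟩] = λ^{|p|}`, `λ = λ(β) = I₁(β)/I₀(β)`.

We phrase paths homologically, which is all the argument uses: a **unit chain** from `x` to `y`
on the bond system is an integer 1-chain `T : ι → {−1, 0, 1}` whose holonomy is the relative
angle, `∏_a χ_a(θ)^{T_a} = θ̄_x θ_y` for all `θ` (`BondSystem.UnitChain`; the signed indicator of
a simple path is one, `|T|₁ = |p|`, and two simple paths share `overlap T T'` bonds).  Results
(all PROVED):

* `nishimoriAvg_cexpect_diff_mul_holonomy` — **(2.8)**: `𝔼_β[⟨θ̄_x θ_y⟩_u · U_T(u)] = λ^{|T|₁}`,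
  `U_T(u) = ∏_a u_a^{T_a}` the disorder holonomy;
* `nishimoriAvg_holonomy` — `𝔼_β[U_T] = λ^{|T|₁}` (independence of the phases);
* `nishimoriAvg_holonomy_mul_conj_le` — the pair bound behind Lemma 2.5:
  `𝔼_β[U_T \overline{U_{T'}}] = ∏_a I_{T_a − T'_a}(β)/I₀(β) ≤ λ^{|T|₁ + |T'|₁ − 2·overlap(T,T')}`
  (bonds used by exactly one chain contribute `λ`, shared bonds at most `1`).

## References

* C. Garban, T. Spencer, J. Math. Phys. 63 (2022) 093302, arXiv:2109.01617, §2: (2.5), (2.7),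
  (2.8), proof of Lemma 2.5 (first display). [GarbanSpencer2022]
-/

noncomputable section

open MeasureTheory Finset TopologicalSpace
open scoped BigOperators ComplexConjugate

namespace Literature.Probability.LatticeModels

/-! ### Per-bond moments -/

section Moments

variable [MeasurableSpace Circle] [BorelSpace Circle]

/-- A unit moment of the von Mises law is a power of `λ`: `I_k(β)/I₀(β) = λ^{|k|}` for `|k| ≤ 1`.
[cite: GarbanSpencer2022, (2.5)] -/
theorem besselI_div_eq_vonMisesMean_pow {β : ℝ} (hβ : 0 < β) {k : ℤ} (hk : k.natAbs ≤ 1) :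
    besselI k β / besselI 0 β = vonMisesMean β ^ k.natAbs := by
  have h0 : besselI 0 β ≠ 0 := (besselI_pos hβ 0).ne'
  rcases Nat.le_one_iff_eq_zero_or_eq_one.1 hk with h | h
  · rw [Int.natAbs_eq_zero.1 h, Int.natAbs_zero, pow_zero, div_self h0]
  · rw [h, pow_one, vonMisesMean_eq]
    rcases Int.natAbs_eq k with hk' | hk' <;> rw [hk', h]
    · rfl
    · push_cast; rw [besselI_neg_index]

/-- The pair-bond moment bound: for unit coefficients `k, k'`,
`I_{k−k'}(β)/I₀(β) ≤ λ^{[exactly one of k, k' is non-zero]}` (a bond used once contributes `λ`, a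
bond used by both paths at most `1`). [cite: GarbanSpencer2022, proof of Lemma 2.5, first display] -/
theorem besselI_sub_div_le {β : ℝ} (hβ : 0 < β) {k k' : ℤ} (hk : k.natAbs ≤ 1) (hk' : k'.natAbs ≤ 1) :
    besselI (k - k') β / besselI 0 β ≤
      vonMisesMean β ^ (if (k ≠ 0 ∧ k' = 0) ∨ (k = 0 ∧ k' ≠ 0) then 1 else 0) := by
  have hl0 := (vonMisesMean_pos hβ).le
  have hl1 := vonMisesMean_le_one hβ
  split_ifs with h
  · rw [pow_one]
    rcases h with ⟨h1, h2⟩ | ⟨h1, h2⟩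
    · rw [h2, sub_zero, besselI_div_eq_vonMisesMean_pow hβ hk]
      have : k.natAbs = 1 := by have := Int.natAbs_ne_zero.2 h1; omega
      rw [this, pow_one]
    · rw [h1, zero_sub, besselI_neg_index, besselI_div_eq_vonMisesMean_pow hβ hk']
      have : k'.natAbs = 1 := by have := Int.natAbs_ne_zero.2 h2; omega
      rw [this, pow_one]
  · rw [pow_zero]
    exact (vonMises_moment_mem_Ioc hβ _).2

end Moments

namespace BondSystem

variable {V ι : Type*} (G : BondSystem V ι)

/-! ### Unit chains and holonomies -/

/-- A **unit chain from `x` to `y`** on a bond system: an integer 1-chain with coefficients in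
`{−1, 0, 1}` whose holonomy in every spin configuration is the relative angle `θ̄_x θ_y` — the
homological content of "a simple path from `x` to `y`" (its signed indicator), which is all that
Garban–Spencer's telescoping `e^{i(θ(0)−θ(n))} ∏_{(ij)∈p} e^{iω_{ij}} = ∏_{(ij)∈p} Y_{ij}` uses.
[cite: GarbanSpencer2022, §2 Step 1, (2.7)–(2.8)] -/
structure UnitChain [Fintype ι] (x y : V) where
  /-- the signed multiplicity `T_a ∈ {−1, 0, 1}` of the bond `a` -/
  coeff : ι → ℤ
  /-- coefficients are units or zero -/
  natAbs_le : ∀ a, (coeff a).natAbs ≤ 1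
  /-- the holonomy is the relative angle: `∏_a χ_a(θ)^{T_a} = θ̄_x θ_y` -/
  boundary : ∀ θ : V → Circle,
    ∏ a, ((G.bondChar a θ : Circle) : ℂ) ^ coeff a = ((diffChar x y θ : Circle) : ℂ)

variable [Fintype ι]

namespace UnitChain

variable {G} {x y : V} (T : G.UnitChain x y)

/-- The length `|T|₁ = ∑_a |T_a|` of a unit chain (the number of bonds of the path).
[cite: GarbanSpencer2022, §2 Step 1 (`|p|`)] -/
def length : ℕ := ∑ a, (T.coeff a).natAbs

/-- The **disorder holonomy** `U_T(u) = ∏_a u_a^{T_a} = ∏_{(ij)∈p} e^{iω_{ij}}` along the chain.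
[cite: GarbanSpencer2022, (2.8)] -/
def holonomy (u : ι → Circle) : ℂ := ∏ a, ((u a : Circle) : ℂ) ^ T.coeff a

/-- `|U_T(u)| = 1`. [folklore] -/
theorem norm_holonomy (u : ι → Circle) : ‖T.holonomy u‖ = 1 := by
  simp [holonomy, norm_prod, norm_zpow]

/-- The holonomy is continuous in the phases. [folklore] -/
theorem continuous_holonomy : Continuous T.holonomy :=
  continuous_finsetProd _ fun a _ => (continuous_subtype_val.comp (continuous_apply a)).zpow₀ _
    fun _ => Or.inl (Circle.coe_ne_zero _)

/-- **Telescoping**: `θ̄_x θ_y · U_T(u) = ∏_a Y_a(θ,u)^{T_a}` — the relative angle times the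
disorder holonomy is a function of the bond variables alone.
[cite: GarbanSpencer2022, §2 Step 1, display before (2.8)] -/
theorem diffChar_mul_holonomy (u : ι → Circle) (θ : V → Circle) :
    ((diffChar x y θ : Circle) : ℂ) * T.holonomy u =
      ∏ a, ((G.bondVar u θ a : Circle) : ℂ) ^ T.coeff a := by
  rw [← T.boundary θ, holonomy, ← Finset.prod_mul_distrib]
  refine Finset.prod_congr rfl fun a _ => ?_
  rw [G.bondVar_eq_mul_bondChar, Circle.coe_mul, mul_zpow, mul_comm]

/-- The number of bonds used by both chains. [cite: GarbanSpencer2022, Lemma 2.5 (`|p₁ ∩ p₂|`)] -/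
def overlap (T T' : G.UnitChain x y) : ℕ := #{a | T.coeff a ≠ 0 ∧ T'.coeff a ≠ 0}

/-- The number of bonds used by exactly one of the two chains. [folklore] -/
def symmDiffCard (T T' : G.UnitChain x y) : ℕ :=
  #{a | (T.coeff a ≠ 0 ∧ T'.coeff a = 0) ∨ (T.coeff a = 0 ∧ T'.coeff a ≠ 0)}

/-- For a unit coefficient, `|T_a| = [T_a ≠ 0]`. [folklore] -/
theorem natAbs_coeff_eq (a : ι) : (T.coeff a).natAbs = if T.coeff a ≠ 0 then 1 else 0 := by
  have h := T.natAbs_le a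
  split_ifs with h0
  · have : (T.coeff a).natAbs ≠ 0 := Int.natAbs_ne_zero.2 h0
    omega
  · push Not at h0; simp [h0]

/-- **Inclusion–exclusion for two paths**: `|T|₁ + |T'|₁ = #(symmetric difference) + 2·overlap`.
[folklore] -/
theorem length_add_length (T T' : G.UnitChain x y) :
    T.length + T'.length = T.symmDiffCard T' + 2 * T.overlap T' := by
  unfold length symmDiffCard overlap
  rw [Finset.card_filter, Finset.card_filter, Finset.mul_sum, ← Finset.sum_add_distrib,
    ← Finset.sum_add_distrib]
  refine Finset.sum_congr rfl fun a _ => ?_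
  rw [T.natAbs_coeff_eq, T'.natAbs_coeff_eq]
  by_cases h1 : T.coeff a = 0 <;> by_cases h2 : T'.coeff a = 0 <;> simp [h1, h2]

end UnitChain

/-! ### The identities -/

section Disorder

variable [MeasurableSpace Circle] [BorelSpace Circle] {x y : V}

/-- **Independence of the phases along a chain**: `𝔼_β[U_T] = ∏_a I_{T_a}(β)/I₀(β)`.
[cite: GarbanSpencer2022, §2 Step 1 ("using the independance from Lemma 2.1")] -/
theorem nishimoriAvg_holonomy_eq_prod (β : ℝ) (T : G.UnitChain x y) :
    nishimoriAvg β T.holonomy = ∏ a, ((besselI (T.coeff a) β / besselI 0 β : ℝ) : ℂ) := by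
  unfold UnitChain.holonomy
  rw [nishimoriAvg_prod β (fun a z => (z : ℂ) ^ T.coeff a)]
  exact Finset.prod_congr rfl fun a _ => vonMises_moment β (T.coeff a)

/-- `𝔼_β[U_T] = λ^{|T|₁}`. [cite: GarbanSpencer2022, §2 Step 1] -/
theorem nishimoriAvg_holonomy {β : ℝ} (hβ : 0 < β) (T : G.UnitChain x y) :
    nishimoriAvg β T.holonomy = ((vonMisesMean β ^ T.length : ℝ) : ℂ) := by
  rw [nishimoriAvg_holonomy_eq_prod, UnitChain.length, ← Finset.prod_pow_eq_pow_sum,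
    Complex.ofReal_prod]
  refine Finset.prod_congr rfl fun a _ => ?_
  rw [besselI_div_eq_vonMisesMean_pow hβ (T.natAbs_le a)]

/-- **The pair bound behind Lemma 2.5**:
`𝔼_β[U_T · \overline{U_{T'}}] = ∏_a I_{T_a − T'_a}(β)/I₀(β)` is a real number in
`[0, λ^{|T|₁ + |T'|₁ − 2 overlap}]`; stated as: it equals some real `m` with
`0 ≤ m ≤ λ^{symmDiffCard}`. [cite: GarbanSpencer2022, proof of Lemma 2.5, first display] -/
theorem nishimoriAvg_holonomy_mul_conj {β : ℝ} (hβ : 0 < β) (T T' : G.UnitChain x y) :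
    ∃ m : ℝ, 0 ≤ m ∧ m ≤ vonMisesMean β ^ T.symmDiffCard T' ∧
      nishimoriAvg β (fun u => T.holonomy u * conj (T'.holonomy u)) = (m : ℂ) := by
  refine ⟨∏ a, besselI (T.coeff a - T'.coeff a) β / besselI 0 β,
    Finset.prod_nonneg fun a _ => (vonMises_moment_mem_Ioc hβ _).1.le, ?_, ?_⟩
  · unfold UnitChain.symmDiffCard
    rw [Finset.card_filter, ← Finset.prod_pow_eq_pow_sum]
    exact Finset.prod_le_prod (fun a _ => (vonMises_moment_mem_Ioc hβ _).1.le)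
      fun a _ => besselI_sub_div_le hβ (T.natAbs_le a) (T'.natAbs_le a)
  · have e : (fun u => T.holonomy u * conj (T'.holonomy u)) =
        fun u : ι → Circle => ∏ a, ((u a : Circle) : ℂ) ^ (T.coeff a - T'.coeff a) := by
      funext u
      simp only [UnitChain.holonomy, map_prod, map_zpow₀, ← Finset.prod_mul_distrib]
      refine Finset.prod_congr rfl fun a _ => ?_
      rw [← Circle.coe_inv_eq_conj, Circle.coe_inv, inv_zpow', ← zpow_add₀ (Circle.coe_ne_zero _),
        sub_eq_add_neg]
    rw [e, nishimoriAvg_prod β (fun a z => (z : ℂ) ^ (T.coeff a - T'.coeff a)), Complex.ofReal_prod]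
    exact Finset.prod_congr rfl fun a _ => vonMises_moment β _

end Disorder

section Quenched

variable [Fintype V] [MeasurableSpace Circle] [BorelSpace Circle] {x y : V}

/-- A `u`-dependent constant factor leaves the quenched expectation: `⟨F · c⟩_u = ⟨F⟩_u · c`.
[folklore] -/
theorem cexpect_mul_const (β : ℝ) (u : ι → Circle) (F : (V → Circle) → ℂ) (c : ℂ) :
    G.cexpect β u (fun θ => F θ * c) = G.cexpect β u F * c := by
  simp only [cexpect]
  rw [div_mul_eq_mul_div, ← integral_mul_const]
  congr 1
  refine integral_congr_ae (ae_of_all _ fun θ => ?_)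
  ring
set_option maxHeartbeats 400000 in
/-- **Garban–Spencer (2.8): the Nishimori path identity.**
`𝔼^{XY}_β[⟨θ̄_x θ_y⟩_{u,β} · U_T(u)] = λ(β)^{|T|₁}` for every unit chain `T` from `x` to `y`:
by telescoping, `θ̄_x θ_y U_T = ∏_a Y_a^{T_a}` is a function of the bond variables, whose averaged
quenched law is the i.i.d. von Mises law (Lemma 2.1). [cite: GarbanSpencer2022, (2.8)] -/
theorem nishimoriAvg_cexpect_diff_mul_holonomy {β : ℝ} (hβ : 0 < β) (T : G.UnitChain x y) :
    nishimoriAvg β (fun u => G.cexpect β u (fun θ => ((diffChar x y θ : Circle) : ℂ)) * T.holonomy u) =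
      ((vonMisesMean β ^ T.length : ℝ) : ℂ) := by
  have hF : Continuous fun w : ι → Circle => ∏ a, ((w a : Circle) : ℂ) ^ T.coeff a :=
    T.continuous_holonomy
  calc nishimoriAvg β (fun u => G.cexpect β u (fun θ => ((diffChar x y θ : Circle) : ℂ)) * T.holonomy u)
      = nishimoriAvg β (fun u => G.cexpect β u
          (fun θ => ∏ a, ((G.bondVar u θ a : Circle) : ℂ) ^ T.coeff a)) := by
        congr 1; funext u
        rw [← cexpect_mul_const]
        simp only [T.diffChar_mul_holonomy]
    _ = nishimoriAvg β (fun w : ι → Circle => ∏ a, ((w a : Circle) : ℂ) ^ T.coeff a) :=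
        G.nishimoriAvg_cexpect_bondVar β hF
    _ = _ := G.nishimoriAvg_holonomy hβ T

end Quenched

end BondSystem

end Literature.Probability.LatticeModels
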